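import Mathlib.Data.Real.Basic
import Mathlib.Tactic.Linarith
import Mathlib.Tactic.NormNum
import Mathlib.Tactic.FieldSimp
import Mathlib.Tactic.Ring
import Mathlib.Tactic.Positivity

/-!
# The ⁶³Cu Knight-shift scale of the planar hole concentration in (multilayered) cuprates, as printed, and its exact algebra

In a cuprate with `n ≥ 3` CuO₂ planes per cell the outer planes (OP, pyramidal, next to the
charge reservoir) and the inner planes (IP, square-planar) carry DIFFERENT hole concentrations,
and the usual total-charge scales (Presland–Tallon parabola `PreslandTallonParabola.lean`,
thermopower `ThermopowerDopingScale.lean`, bond-valence sums) cannot resolve them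
[MukudaEtAl2012, §2.3; ShimizuEtAl2011, p. 5].  The Osaka group ASSIGNS a hole concentration `p`
per planar Cu to each plane from the spin part of the room-temperature in-plane ⁶³Cu Knight shift
`K = K_s^{ab}(RT)` (in %) through a printed LINEAR relation.  Two such relations are in print:
```
F1 :  p′ = 0.502 K + 0.0462     [KotegawaEtAl2001; as printed in MukudaEtAl2012 §2.3 and
                                  ShimizuEtAl2011 p. 1] (calibrated on NQR-derived p),
F2 :  p  = 0.492 K − 0.023      [MukudaEtAl2012 §2.3, Fig. 5, «fitting with the data for
                                  K_s^{ab}(RT) < 0.5 %»] (calibrated on p from T_c = T_c,max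
                                  [1 − 82.6 (p − 0.16)²] in homologous 1- and 2-layer cuprates),
```
with the printed remark that F1 «had overestimated the hole density by 0.06 ∼ 0.07»
[MukudaEtAl2012, §2.3].

This file makes NO physical claim.  `ksF1`, `ksF2` are DEFINITIONS of the printed formulas and
the theorems are the exact algebra a user of the scale performs:

* §2 strict monotonicity, the inverse maps and both round trips;
* §3 the CONVENTION GAP is the exact affine function `ksF1 K − ksF2 K = 0.010 K + 0.0692`, hence
  ∈ `[0.0692, 0.0742]` on the fitted range `0 ≤ K ≤ 0.5` (the printed «0.06 ∼ 0.07» is this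
  number rounded); the printed «optimal» Knight-shift window `K ∈ [0.35, 0.39] %`
  [MukudaEtAl2012, §2.3] maps to `p′ ∈ [0.2219, 0.2420]` under F1 (the printed «p′ = 0.22 ∼ 0.24»)
  and to `p ∈ [0.1492, 0.16888]` under F2 (which contains the conventional optimum `0.16`);
* §4 the OP–IP LAYER IMBALANCE is intercept-free: `ksF2 K₁ − ksF2 K₂ = 0.492 (K₁ − K₂)`, so the
  two conventions disagree on the imbalance only by `0.010 (K₁ − K₂)` although they disagree on
  each `p` by ≈ 0.07 — the imbalance is the convention-ROBUST member; error bars propagate as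
  `δp = 0.492 δK`;
* §5 bookkeeping of a two-class multilayer: the site-weighted mean `layerMean a b p_OP p_IP`
  (`a` outer, `b` inner planes per cell; trilayer `(2,1)`, five-layer `(2,3)`) lies between
  `p_IP` and `p_OP`, with the exact offsets `p_OP − mean = b (p_OP − p_IP)/(a+b)` etc.;
* §6 the Mila–Rice anisotropy used to extract the supertransferred field `B`:
  `Δ = (A_c + 4B)/(A_ab + 4B)` [ShimizuEtAl2011, Eq. (4); MilaRice1989] inverts to
  `B = (A_c − Δ A_ab)/(4(Δ − 1))`; with the printed on-site fields `A_ab = 37`, `A_c = −170`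
  kOe/μ_B the printed anisotropies `Δ = 0.42 / 0.38 / 0.36 / 0.32` give `B ∈ (79.9, 80.0) /
  (74.2, 74.3) / (71.6, 71.7) / (66.8, 66.9)` kOe/μ_B, i.e. the printed `80 / 74 / 72 / 67`
  [ShimizuEtAl2011, Table I and p. 4];
* §7 the Hg-1223 instance (`T_c = 133 K`, ⁶³Cu data of [MagishiEtAl1995] as tabulated in
  [ShimizuEtAl2011, Table II]: `K_OP = 0.41`, `K_IP = 0.32` %): F2 gives `p_OP = 0.17872`,
  `p_IP = 0.13444`, imbalance `0.04428`, trilayer mean `0.16396`; F1 gives `0.25202 / 0.20684`,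
  imbalance `0.04518`; the curve-read Table II values `0.185 / 0.139` differ from F2 by `< 0.007`;
  likewise the three-layer apical-F compound 0223F (`K = 0.35 / 0.28`) and five-layer Hg-1245.

Not here: whether either relation is right (both are CONVENTIONS of the cell's doping coordinate,
reported side by side, never averaged), the non-linear guide-to-the-eye curve of
[ShimizuEtAl2011, Fig. 4(a)], or any temperature dependence.

References: H. Mukuda, S. Shimizu, A. Iyo, Y. Kitaoka, J. Phys. Soc. Jpn. 81 (2012) 011008
(arXiv:1201.2726), §2.3 and Fig. 5; S. Shimizu et al., Phys. Rev. B 83 (2011) 144523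
(arXiv:1103.3407), Eqs. (3)–(4), Tables I–II; H. Kotegawa et al., Phys. Rev. B 64 (2001) 064515;
F. Mila, T. M. Rice, Phys. Rev. B 40 (1989) 11382; K. Magishi et al., J. Phys. Soc. Jpn. 64
(1995) 4561.
AI-produced formalisation (H21, cell hubbard-downfold, seat lit-2, 2026-08-27); no facts, no
axioms beyond Mathlib's, no `sorry`.
-/

namespace Literature.MathematicalPhysics.QuantumLattice

noncomputable section

/-! ## 1. The printed relations (K in %, p in holes per planar Cu) -/

/-- Relation F1: `p′ = 0.502 K_s^{ab}(RT) + 0.0462`.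
[cite: KotegawaEtAl2001, linear relation p′ = 0.502 K + 0.0462] [cite: MukudaEtAl2012, §2.3 relation F1] [cite: ShimizuEtAl2011, p. 1] -/
def ksF1 (K : ℝ) : ℝ := 0.502 * K + 0.0462

/-- Relation F2 (the «renewed» relation): `p = 0.492 K_s^{ab}(RT) − 0.023`, fitted for `K < 0.5 %`.
[cite: MukudaEtAl2012, §2.3 and Fig. 5 (relation F2)] -/
def ksF2 (K : ℝ) : ℝ := 0.492 * K - 0.023

/-- Unfolding. [cite: KotegawaEtAl2001, relation F1] [cite: MukudaEtAl2012, §2.3] -/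
theorem ksF1_def (K : ℝ) : ksF1 K = 0.502 * K + 0.0462 := rfl

/-- Unfolding. [cite: MukudaEtAl2012, §2.3 relation F2] -/
theorem ksF2_def (K : ℝ) : ksF2 K = 0.492 * K - 0.023 := rfl

/-! ## 2. Monotonicity, inverses, round trips -/

/-- F1 is strictly increasing in the Knight shift («K_s(RT) increases with p»). [cite: KotegawaEtAl2001, relation F1] [cite: MukudaEtAl2012, §2.3] -/
theorem ksF1_strictMono : StrictMono ksF1 := by
  intro a b hab
  simp only [ksF1]
  linarith

/-- F2 is strictly increasing in the Knight shift («K_s^{ab}(RT) monotonically increases with p»). [cite: MukudaEtAl2012, §2.3 relation F2] -/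
theorem ksF2_strictMono : StrictMono ksF2 := by
  intro a b hab
  simp only [ksF2]
  linarith

/-- Hence injective. [cite: MukudaEtAl2012, §2.3 relation F2] -/
theorem ksF2_injective : Function.Injective ksF2 := ksF2_strictMono.injective

/-- Hence injective. [cite: KotegawaEtAl2001, relation F1] [cite: MukudaEtAl2012, §2.3] -/
theorem ksF1_injective : Function.Injective ksF1 := ksF1_strictMono.injective

/-- Inverse of F1: the Knight shift a given `p′` corresponds to. [cite: MukudaEtAl2012, §2.3] -/
def ksF1Inv (p : ℝ) : ℝ := (p - 0.0462) / 0.502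

/-- Inverse of F2: the Knight shift a given `p` corresponds to. [cite: MukudaEtAl2012, §2.3] -/
def ksF2Inv (p : ℝ) : ℝ := (p + 0.023) / 0.492

/-- Round trip. [cite: KotegawaEtAl2001, relation F1] [cite: MukudaEtAl2012, §2.3] -/
theorem ksF1_ksF1Inv (p : ℝ) : ksF1 (ksF1Inv p) = p := by
  simp only [ksF1, ksF1Inv]
  field_simp
  ring

/-- Round trip. [cite: KotegawaEtAl2001, relation F1] [cite: MukudaEtAl2012, §2.3] -/
theorem ksF1Inv_ksF1 (K : ℝ) : ksF1Inv (ksF1 K) = K := by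
  simp only [ksF1, ksF1Inv]
  field_simp
  ring

/-- Round trip. [cite: MukudaEtAl2012, §2.3 relation F2] -/
theorem ksF2_ksF2Inv (p : ℝ) : ksF2 (ksF2Inv p) = p := by
  simp only [ksF2, ksF2Inv]
  field_simp
  ring

/-- Round trip. [cite: MukudaEtAl2012, §2.3 relation F2] -/
theorem ksF2Inv_ksF2 (K : ℝ) : ksF2Inv (ksF2 K) = K := by
  simp only [ksF2, ksF2Inv]
  field_simp
  ring

/-- The Knight shift that F2 assigns to the conventional optimum `p = 0.16` is `0.183/0.492 %`,
inside the printed empirical optimal window `0.35–0.39 %`. [cite: MukudaEtAl2012, §2.3] -/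
theorem ksF2Inv_optimal : ksF2Inv 0.16 = 0.183 / 0.492 ∧
    0.3719 < ksF2Inv 0.16 ∧ ksF2Inv 0.16 < 0.372 := by
  refine ⟨?_, ?_, ?_⟩ <;> norm_num [ksF2Inv]

/-! ## 3. The convention gap F1 − F2 -/

/-- The two printed relations differ by an exact affine function of `K`. [cite: KotegawaEtAl2001, relation F1] [cite: MukudaEtAl2012, §2.3] [cite: MukudaEtAl2012, §2.3 relation F2] -/
theorem ksF1_sub_ksF2 (K : ℝ) : ksF1 K - ksF2 K = 0.010 * K + 0.0692 := by
  simp only [ksF1, ksF2]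
  ring

/-- On the fitted range `0 ≤ K ≤ 0.5 %` the gap is between `0.0692` and `0.0742` holes per Cu
(printed, rounded: «overestimated the hole density by 0.06 ∼ 0.07»). [cite: MukudaEtAl2012, §2.3] -/
theorem ksF1_sub_ksF2_bounds {K : ℝ} (h0 : 0 ≤ K) (h5 : K ≤ 0.5) :
    0.0692 ≤ ksF1 K - ksF2 K ∧ ksF1 K - ksF2 K ≤ 0.0742 := by
  rw [ksF1_sub_ksF2]
  constructor <;> linarith

/-- The printed «optimal» Knight-shift window `K_s(RT) ∈ [0.35, 0.39] %` under F1 is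
`p′ ∈ [0.2219, 0.24198]` — the printed «p′ = 0.22 ∼ 0.24». [cite: MukudaEtAl2012, §2.3] -/
theorem optimalWindow_F1 {K : ℝ} (h1 : 0.35 ≤ K) (h2 : K ≤ 0.39) :
    0.2219 ≤ ksF1 K ∧ ksF1 K ≤ 0.24198 := by
  simp only [ksF1]
  constructor <;> linarith

/-- The same window under F2 is `p ∈ [0.1492, 0.16888]`, which contains `0.16`.
[cite: MukudaEtAl2012, §2.3] -/
theorem optimalWindow_F2 {K : ℝ} (h1 : 0.35 ≤ K) (h2 : K ≤ 0.39) :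
    0.1492 ≤ ksF2 K ∧ ksF2 K ≤ 0.16888 := by
  simp only [ksF2]
  constructor <;> linarith

/-- Conversely `p = 0.16` is reached inside the printed window. [cite: MukudaEtAl2012, §2.3 relation F2] -/
theorem optimalWindow_F2_contains : ksF2 (ksF2Inv 0.16) = 0.16 ∧
    0.35 ≤ ksF2Inv 0.16 ∧ ksF2Inv 0.16 ≤ 0.39 := by
  refine ⟨ksF2_ksF2Inv 0.16, ?_, ?_⟩ <;> norm_num [ksF2Inv]

/-! ## 4. The layer imbalance is intercept-free; error bars -/

/-- Under F2 the difference of two assigned hole densities depends only on the difference of the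
two Knight shifts. [cite: MukudaEtAl2012, §2.3 relation F2] -/
theorem ksF2_sub (K₁ K₂ : ℝ) : ksF2 K₁ - ksF2 K₂ = 0.492 * (K₁ - K₂) := by
  simp only [ksF2]
  ring

/-- Same for F1 with slope `0.502`. [cite: KotegawaEtAl2001, relation F1] [cite: MukudaEtAl2012, §2.3] -/
theorem ksF1_sub (K₁ K₂ : ℝ) : ksF1 K₁ - ksF1 K₂ = 0.502 * (K₁ - K₂) := by
  simp only [ksF1]
  ring

/-- The two conventions disagree on an OP–IP imbalance only by `0.010 (K_OP − K_IP)`. [cite: KotegawaEtAl2001, relation F1] [cite: MukudaEtAl2012, §2.3] [cite: MukudaEtAl2012, §2.3 relation F2] -/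
theorem imbalance_convention_gap (K₁ K₂ : ℝ) :
    (ksF1 K₁ - ksF1 K₂) - (ksF2 K₁ - ksF2 K₂) = 0.010 * (K₁ - K₂) := by
  rw [ksF1_sub, ksF2_sub]
  ring

/-- Error propagation: a Knight-shift uncertainty `δ` is a hole-density uncertainty `0.492 δ`. [cite: MukudaEtAl2012, §2.3 relation F2] -/
theorem ksF2_errorBar (K δ : ℝ) : ksF2 (K + δ) - ksF2 K = 0.492 * δ := by
  rw [ksF2_sub]
  ring

/-- Absolute form: `|δp| = 0.492 |δK|`. [cite: MukudaEtAl2012, §2.3 relation F2] -/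
theorem ksF2_abs_sub (K K' : ℝ) : |ksF2 K' - ksF2 K| = 0.492 * |K' - K| := by
  rw [ksF2_sub, abs_mul, abs_of_pos (by norm_num : (0 : ℝ) < 0.492)]

/-- Absolute form for F1: `|δp′| = 0.502 |δK|`. [cite: KotegawaEtAl2001, relation F1] [cite: MukudaEtAl2012, §2.3] -/
theorem ksF1_abs_sub (K K' : ℝ) : |ksF1 K' - ksF1 K| = 0.502 * |K' - K| := by
  rw [ksF1_sub, abs_mul, abs_of_pos (by norm_num : (0 : ℝ) < 0.502)]

/-! ## 5. Two-class multilayer bookkeeping (a outer planes, b inner planes per cell) -/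

/-- Site-weighted mean hole density of a cell with `a` outer planes at `pOP` and `b` inner planes at
`pIP`; the «average doping» / «total hole density» of a multilayer that the total-charge scales measure. [cite: MukudaEtAl2012, §2.3] [cite: ShimizuEtAl2011, p. 5] -/
def layerMean (a b pOP pIP : ℝ) : ℝ := (a * pOP + b * pIP) / (a + b)

/-- Trilayer (Hg-1223, 0223F): two outer, one inner plane. [cite: ShimizuEtAl2011, Fig. 3(a) and p. 5] -/
def trilayerAvg (pOP pIP : ℝ) : ℝ := layerMean 2 1 pOP pIP

/-- Five-layer (Hg-1245): two outer, three inner planes. [cite: MukudaEtAl2012, §3.1] -/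
def fiveLayerAvg (pOP pIP : ℝ) : ℝ := layerMean 2 3 pOP pIP

/-- Unfolding. [cite: MukudaEtAl2012, §2.3] [cite: ShimizuEtAl2011, p. 5] -/
theorem layerMean_def (a b pOP pIP : ℝ) :
    layerMean a b pOP pIP = (a * pOP + b * pIP) / (a + b) := rfl

/-- The trilayer mean is `(2 p_OP + p_IP)/3`. [cite: MukudaEtAl2012, §2.3] [cite: ShimizuEtAl2011, p. 5] -/
theorem trilayerAvg_eq (pOP pIP : ℝ) : trilayerAvg pOP pIP = (2 * pOP + pIP) / 3 := by
  simp only [trilayerAvg, layerMean]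
  norm_num

/-- The five-layer mean is `(2 p_OP + 3 p_IP)/5`. [cite: MukudaEtAl2012, §2.3] [cite: ShimizuEtAl2011, p. 5] -/
theorem fiveLayerAvg_eq (pOP pIP : ℝ) : fiveLayerAvg pOP pIP = (2 * pOP + 3 * pIP) / 5 := by
  simp only [fiveLayerAvg, layerMean]
  norm_num

/-- Equal planes: the mean is the common value. [cite: MukudaEtAl2012, §2.3] [cite: ShimizuEtAl2011, p. 5] -/
theorem layerMean_self (a b p : ℝ) (h : a + b ≠ 0) : layerMean a b p p = p := by
  simp only [layerMean]
  rw [div_eq_iff h]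
  ring

/-- Exact offsets of the two planes from the mean. [cite: MukudaEtAl2012, §2.3] [cite: ShimizuEtAl2011, p. 5] -/
theorem sub_layerMean (a b pOP pIP : ℝ) (h : a + b ≠ 0) :
    pOP - layerMean a b pOP pIP = b * (pOP - pIP) / (a + b) := by
  simp only [layerMean]
  field_simp
  ring

/-- The mean exceeds the inner-plane value by `a (p_OP − p_IP)/(a+b)`. [cite: MukudaEtAl2012, §2.3] [cite: ShimizuEtAl2011, p. 5] -/
theorem layerMean_sub (a b pOP pIP : ℝ) (h : a + b ≠ 0) :
    layerMean a b pOP pIP - pIP = a * (pOP - pIP) / (a + b) := by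
  simp only [layerMean]
  field_simp
  ring

/-- The mean lies between the two plane values (the usual case `pIP ≤ pOP`). [cite: MukudaEtAl2012, §2.3] [cite: ShimizuEtAl2011, p. 5] -/
theorem layerMean_mem {a b pOP pIP : ℝ} (ha : 0 < a) (hb : 0 < b) (h : pIP ≤ pOP) :
    pIP ≤ layerMean a b pOP pIP ∧ layerMean a b pOP pIP ≤ pOP := by
  have hab : 0 < a + b := by linarith
  constructor
  · rw [layerMean, le_div_iff₀ hab]
    nlinarith
  · rw [layerMean, div_le_iff₀ hab]
    nlinarith

/-- Trilayer case of `layerMean_mem`. [cite: MukudaEtAl2012, §2.3] [cite: ShimizuEtAl2011, p. 5] -/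
theorem trilayerAvg_mem {pOP pIP : ℝ} (h : pIP ≤ pOP) :
    pIP ≤ trilayerAvg pOP pIP ∧ trilayerAvg pOP pIP ≤ pOP :=
  layerMean_mem (by norm_num) (by norm_num) h

/-- Filling per site `n = 1 − p` averages the same way: the site-averaged filling of the cell is
the layer mean of the plane fillings. [cite: MukudaEtAl2012, §2.3] [cite: ShimizuEtAl2011, p. 5] -/
theorem one_sub_layerMean (a b pOP pIP : ℝ) (h : a + b ≠ 0) :
    1 - layerMean a b pOP pIP = layerMean a b (1 - pOP) (1 - pIP) := by
  simp only [layerMean]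
  field_simp
  ring

/-- The trilayer mean moves by one third of any change of the inner-plane value and two thirds of
any change of the outer-plane value. [cite: MukudaEtAl2012, §2.3] [cite: ShimizuEtAl2011, p. 5] -/
theorem trilayerAvg_sub (pOP pIP pOP' pIP' : ℝ) :
    trilayerAvg pOP pIP - trilayerAvg pOP' pIP' = (2 * (pOP - pOP') + (pIP - pIP')) / 3 := by
  rw [trilayerAvg_eq, trilayerAvg_eq]
  ring

/-! ## 6. Mila–Rice anisotropy and the supertransferred field B -/

/-- Knight-shift anisotropy `Δ = K_{s,c}/K_{s,ab} = (A_c + 4B)/(A_ab + 4B)` for an isotropic spin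
susceptibility. [cite: ShimizuEtAl2011, Eq. (4)] [cite: MilaRice1989, hyperfine Hamiltonian] -/
def milaRiceDelta (Aab Ac B : ℝ) : ℝ := (Ac + 4 * B) / (Aab + 4 * B)

/-- Its inversion for the supertransferred field: `B = (A_c − Δ A_ab)/(4(Δ − 1))` (the step «∆ is evaluated … which provide B» of [ShimizuEtAl2011, p. 4]). [cite: ShimizuEtAl2011, Eq. (4) and p. 4] -/
def milaRiceB (Aab Ac Δ : ℝ) : ℝ := (Ac - Δ * Aab) / (4 * (Δ - 1))

/-- Unfolding. [cite: ShimizuEtAl2011, Eq. (4)] [cite: MilaRice1989, hyperfine Hamiltonian] -/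
theorem milaRiceDelta_def (Aab Ac B : ℝ) :
    milaRiceDelta Aab Ac B = (Ac + 4 * B) / (Aab + 4 * B) := rfl

/-- Unfolding. [cite: ShimizuEtAl2011, Eq. (4)] [cite: MilaRice1989, hyperfine Hamiltonian] -/
theorem milaRiceB_def (Aab Ac Δ : ℝ) : milaRiceB Aab Ac Δ = (Ac - Δ * Aab) / (4 * (Δ - 1)) := rfl

/-- Round trip: the inversion recovers `B` (hypotheses: the denominators do not vanish, i.e.
`A_ab + 4B ≠ 0` and `A_c ≠ A_ab`, equivalently `Δ ≠ 1`). [cite: ShimizuEtAl2011, Eq. (4)] [cite: MilaRice1989, hyperfine Hamiltonian] -/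
theorem milaRiceB_delta (Aab Ac B : ℝ) (h1 : Aab + 4 * B ≠ 0) (h2 : Ac ≠ Aab) :
    milaRiceB Aab Ac (milaRiceDelta Aab Ac B) = B := by
  have h3 : (Ac + 4 * B) / (Aab + 4 * B) - 1 ≠ 0 := by
    rw [div_sub_one h1]
    refine div_ne_zero ?_ h1
    intro h
    apply h2
    linarith
  simp only [milaRiceB, milaRiceDelta]
  rw [div_eq_iff (mul_ne_zero (by norm_num) h3)]
  field_simp
  ring

/-- Converse round trip: the anisotropy of the inverted `B` is `Δ` (`Δ ≠ 1`, `A_c ≠ A_ab`). [cite: ShimizuEtAl2011, Eq. (4)] [cite: MilaRice1989, hyperfine Hamiltonian] -/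
theorem milaRiceDelta_B (Aab Ac Δ : ℝ) (h1 : Δ ≠ 1) (h2 : Ac ≠ Aab) :
    milaRiceDelta Aab Ac (milaRiceB Aab Ac Δ) = Δ := by
  have h4 : (4 : ℝ) * (Δ - 1) ≠ 0 := mul_ne_zero (by norm_num) (sub_ne_zero.mpr h1)
  have key1 : Aab + 4 * milaRiceB Aab Ac Δ = 4 * (Ac - Aab) / (4 * (Δ - 1)) := by
    simp only [milaRiceB]
    field_simp
    ring
  have key2 : Ac + 4 * milaRiceB Aab Ac Δ = 4 * Δ * (Ac - Aab) / (4 * (Δ - 1)) := by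
    simp only [milaRiceB]
    field_simp
    ring
  have h5 : (4 : ℝ) * (Ac - Aab) ≠ 0 := mul_ne_zero (by norm_num) (sub_ne_zero.mpr h2)
  have h3 : Aab + 4 * milaRiceB Aab Ac Δ ≠ 0 := by
    rw [key1]
    exact div_ne_zero h5 h4
  rw [milaRiceDelta, div_eq_iff h3, key1, key2]
  field_simp

/-- With the printed material-independent on-site fields `A_ab = 37`, `A_c = −170` kOe/μ_B the
printed anisotropies reproduce the printed `B` values: 0212F(♯1) `Δ = 0.42 ↦ 80`,
0212F(♯2) `0.38 ↦ 74`, 0223F OP `0.36 ↦ 72`, IP `0.32 ↦ 67` kOe/μ_B.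
[cite: ShimizuEtAl2011, Table I, p. 3 and p. 4] -/
theorem milaRiceB_printed :
    79.9 < milaRiceB 37 (-170) 0.42 ∧ milaRiceB 37 (-170) 0.42 < 80 ∧
    74.2 < milaRiceB 37 (-170) 0.38 ∧ milaRiceB 37 (-170) 0.38 < 74.3 ∧
    71.6 < milaRiceB 37 (-170) 0.36 ∧ milaRiceB 37 (-170) 0.36 < 71.7 ∧
    66.8 < milaRiceB 37 (-170) 0.32 ∧ milaRiceB 37 (-170) 0.32 < 66.9 := by
  refine ⟨?_, ?_, ?_, ?_, ?_, ?_, ?_, ?_⟩ <;> norm_num [milaRiceB]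

/-- `B` read through the inversion is strictly increasing in the measured anisotropy `Δ` on
`Δ < 1` when `A_c < A_ab` (the printed signs): a larger `K_c/K_ab` means a larger supertransferred
field. [cite: ShimizuEtAl2011, Eq. (4)] [cite: MilaRice1989, hyperfine Hamiltonian] -/
theorem milaRiceB_strictMonoOn {Aab Ac : ℝ} (h : Ac < Aab) :
    StrictMonoOn (milaRiceB Aab Ac) (Set.Iio 1) := by
  intro x hx y hy hxy
  simp only [Set.mem_Iio] at hx hy
  have flip : ∀ z : ℝ, z < 1 → milaRiceB Aab Ac z = (z * Aab - Ac) / (4 * (1 - z)) := by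
    intro z hz
    have hz1 : (4 : ℝ) * (z - 1) ≠ 0 := mul_ne_zero (by norm_num) (by linarith)
    have hz2 : (4 : ℝ) * (1 - z) ≠ 0 := mul_ne_zero (by norm_num) (by linarith)
    simp only [milaRiceB]
    rw [div_eq_div_iff hz1 hz2]
    ring
  rw [flip x hx, flip y hy, div_lt_div_iff₀ (by linarith) (by linarith)]
  nlinarith [mul_lt_mul_of_pos_right hxy (sub_pos.mpr h)]

/-! ## 7. Instances: Hg-1223, 0223F, Hg-1245 (Knight shifts as tabulated in ShimizuEtAl2011 Table II) -/

/-- Hg-1223 (`T_c = 133 K`; data of MagishiEtAl1995): `K_OP = 0.41`, `K_IP = 0.32 %` under F2.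
[cite: ShimizuEtAl2011, Table II] [cite: MukudaEtAl2012, §2.3 relation F2] [cite: MagishiEtAl1995, Knight-shift data] -/
theorem hg1223_F2 : ksF2 0.41 = 0.17872 ∧ ksF2 0.32 = 0.13444 := by
  constructor <;> norm_num [ksF2]

/-- The same under F1. [cite: ShimizuEtAl2011, Table II] [cite: KotegawaEtAl2001, relation F1] -/
theorem hg1223_F1 : ksF1 0.41 = 0.25202 ∧ ksF1 0.32 = 0.20684 := by
  constructor <;> norm_num [ksF1]

/-- The OP–IP imbalance of Hg-1223 under the two conventions: `0.04428` (F2) vs `0.04518` (F1). [cite: ShimizuEtAl2011, Table II] [cite: KotegawaEtAl2001, relation F1] [cite: MukudaEtAl2012, §2.3] [cite: MukudaEtAl2012, §2.3 relation F2] -/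
theorem hg1223_imbalance :
    ksF2 0.41 - ksF2 0.32 = 0.04428 ∧ ksF1 0.41 - ksF1 0.32 = 0.04518 := by
  constructor <;> norm_num [ksF1, ksF2]

/-- The curve-read Table II entries `p′ = 0.185 (OP), 0.139 (IP)` differ from F2 by less than
`0.007`; their imbalance is `0.046`. [cite: ShimizuEtAl2011, Table II] -/
theorem hg1223_tableII_vs_F2 :
    |0.185 - ksF2 0.41| < 0.007 ∧ |0.139 - ksF2 0.32| < 0.005 ∧
    (0.185 : ℝ) - 0.139 = 0.046 := by
  refine ⟨?_, ?_, by norm_num⟩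
  · rw [hg1223_F2.1]; norm_num [abs_of_pos]
  · rw [hg1223_F2.2]; norm_num [abs_of_pos]

/-- Trilayer means: `0.16396` (F2), `0.509/3 ∈ (0.1696, 0.1697)` (Table II), `0.23696` (F1);
plane fillings `n = 1 − p` under F2: `n_OP = 0.82128`, `n_IP = 0.86556`. [cite: ShimizuEtAl2011, Table II] [cite: MukudaEtAl2012, §2.3 relation F2] -/
theorem hg1223_means :
    trilayerAvg (ksF2 0.41) (ksF2 0.32) = 0.16396 ∧
    trilayerAvg 0.185 0.139 = 0.509 / 3 ∧
    0.1696 < trilayerAvg 0.185 0.139 ∧ trilayerAvg 0.185 0.139 < 0.1697 ∧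
    trilayerAvg (ksF1 0.41) (ksF1 0.32) = 0.23696 ∧
    1 - ksF2 0.41 = 0.82128 ∧ 1 - ksF2 0.32 = 0.86556 := by
  refine ⟨?_, ?_, ?_, ?_, ?_, ?_, ?_⟩ <;> norm_num [trilayerAvg_eq, ksF1, ksF2]

/-- Three-layered apical-F 0223F (`T_c = 120 K`): `K = 0.35 / 0.28 %` ↦ F2 `0.1492 / 0.11476`
(Table II curve-read `0.156 / 0.115`), imbalance `0.03444`. [cite: ShimizuEtAl2011, Table II] -/
theorem f0223_F2 : ksF2 0.35 = 0.1492 ∧ ksF2 0.28 = 0.11476 ∧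
    ksF2 0.35 - ksF2 0.28 = 0.03444 := by
  refine ⟨?_, ?_, ?_⟩ <;> norm_num [ksF2]

/-- Five-layered Hg-1245 (`T_c = 108 K`): `K = 0.34 / 0.21 %` ↦ F2 `0.14428 / 0.08032`
(Table II `0.151 / 0.075`), imbalance `0.06396`, five-layer mean `0.105904`.
[cite: ShimizuEtAl2011, Table II] -/
theorem hg1245_F2 : ksF2 0.34 = 0.14428 ∧ ksF2 0.21 = 0.08032 ∧
    ksF2 0.34 - ksF2 0.21 = 0.06396 ∧
    fiveLayerAvg (ksF2 0.34) (ksF2 0.21) = 0.105904 := by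
  refine ⟨?_, ?_, ?_, ?_⟩ <;> norm_num [ksF2, fiveLayerAvg_eq]

/-! ## 8. Layer-number-specific lines (Itoh 2015): S1 for single-layer Hg1201, D1 for double-layer Hg1212

[Itoh2015HgKnightShift] re-fits the room-temperature plane-site spin shift against the TITRATED hole
content `p_h` of [Fukuoka et al. 1997] separately for the single-layer and the double-layer mercury
cuprate and prints two least-squares lines (p. 2 and Fig. 3): «S1: p_h = 0.63 ⁶³K_s^{ab}(RT) − 0.13
(Hg1201) and D1, p_h = 0.74 ⁶³K_s^{ab}(RT) − 0.04 (Hg1212)», with «⁶³K_orb^{ab} ∼ 0.25 % for Hg1201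
and ∼ 0.20 % for Hg1212», and the extrapolations «⁶³K_s^{ab} = 0.21 % (Hg1201) and … = 0.05 % (Hg1212)
at the phase boundary» `p_h = 0`.  The printed point is that «⁶³K_s^{ab} of Hg1201 is larger than that
of Hg1212 at each doping regime», so «one should take into consideration which type relation is
relevant S1 or D1 to estimate the individual hole concentrations of the non-equivalent CuO₂ planes in
the multi-layer superconductors» (p. 3) — i.e. S1/D1 are ALTERNATIVES to the multilayer lines F1/F2
of §1, calibrated on a different `p` (titration rather than the `T_c` parabola).  This section types
the two lines, their printed intercepts, and the exact gaps to F1/F2, so that a Knight shift quoted for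
a Hg-1212 or Hg-1223 plane can be carried on every printed convention without re-deriving anything. -/

/-- Itoh's single-layer line S1 (Hg1201): `p_h = 0.63 K_s^{ab}(RT) − 0.13` (`K` in %).
[cite: Itoh2015HgKnightShift, p. 2 and Fig. 3] -/
def itohS1 (K : ℝ) : ℝ := 0.63 * K - 0.13

/-- Itoh's double-layer line D1 (Hg1212): `p_h = 0.74 K_s^{ab}(RT) − 0.04` (`K` in %).
[cite: Itoh2015HgKnightShift, p. 2 and Fig. 3] -/
def itohD1 (K : ℝ) : ℝ := 0.74 * K - 0.04

/-- Unfolding. [cite: Itoh2015HgKnightShift, p. 2] -/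
theorem itohS1_def (K : ℝ) : itohS1 K = 0.63 * K - 0.13 := rfl

/-- Unfolding. [cite: Itoh2015HgKnightShift, p. 2] -/
theorem itohD1_def (K : ℝ) : itohD1 K = 0.74 * K - 0.04 := rfl

/-- S1 is strictly increasing in the shift. [cite: Itoh2015HgKnightShift, Fig. 3] -/
theorem itohS1_strictMono : StrictMono itohS1 := by
  intro a b hab
  simp only [itohS1]
  linarith

/-- D1 is strictly increasing in the shift. [cite: Itoh2015HgKnightShift, Fig. 3] -/
theorem itohD1_strictMono : StrictMono itohD1 := by
  intro a b hab
  simp only [itohD1]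
  linarith

/-- **The printed phase-boundary shifts.**  S1 vanishes exactly at `K = 13/63 ∈ (0.2063, 0.2064)` —
the printed «0.21 %» — and D1 exactly at `K = 2/37 ∈ (0.054, 0.0541)` — the printed «0.05 %».
[cite: Itoh2015HgKnightShift, p. 2] -/
theorem itoh_boundary_shifts :
    itohS1 (13 / 63) = 0 ∧ (0.2063 : ℝ) < 13 / 63 ∧ (13 / 63 : ℝ) < 0.2064 ∧
    itohD1 (2 / 37) = 0 ∧ (0.054 : ℝ) < 2 / 37 ∧ (2 / 37 : ℝ) < 0.0541 := by
  refine ⟨?_, ?_, ?_, ?_, ?_, ?_⟩ <;> norm_num [itohS1, itohD1]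

/-- The boundary shifts are the unique zeros (strict monotonicity). [cite: Itoh2015HgKnightShift, p. 2] -/
theorem itoh_boundary_unique (K : ℝ) :
    (itohS1 K = 0 ↔ K = 13 / 63) ∧ (itohD1 K = 0 ↔ K = 2 / 37) := by
  constructor
  · constructor
    · intro h; simp only [itohS1] at h; linarith
    · intro h; rw [h]; norm_num [itohS1]
  · constructor
    · intro h; simp only [itohD1] at h; linarith
    · intro h; rw [h]; norm_num [itohD1]

/-- **Shifts assigned to the conventional optimum `p = 0.16`.**  D1 reaches `0.16` at `K = 10/37 ∈
(0.2702, 0.2703) %`, S1 at `K = 29/63 ∈ (0.4603, 0.4604) %`; for comparison F2 of §1 reaches it at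
`0.183/0.492 ∈ (0.3719, 0.372) %` (`ksF2Inv_optimal`).  Three printed lines, three different
«optimal» room-temperature shifts. [cite: Itoh2015HgKnightShift, p. 2 and Fig. 4] [cite: MukudaEtAl2012, §2.3 relation F2] -/
theorem itoh_optimal_shifts :
    itohD1 (10 / 37) = 0.16 ∧ (0.2702 : ℝ) < 10 / 37 ∧ (10 / 37 : ℝ) < 0.2703 ∧
    itohS1 (29 / 63) = 0.16 ∧ (0.4603 : ℝ) < 29 / 63 ∧ (29 / 63 : ℝ) < 0.4604 := by
  refine ⟨?_, ?_, ?_, ?_, ?_, ?_⟩ <;> norm_num [itohS1, itohD1]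

/-- **Single- vs double-layer at equal shift.**  `D1 − S1 = 0.11 K + 0.09 > 0` for every `K ≥ 0`:
at one and the same room-temperature spin shift the double-layer line assigns MORE holes — the typed
form of «⁶³K_s^{ab} of Hg1201 is larger than that of Hg1212 at each doping regime».
[cite: Itoh2015HgKnightShift, p. 2] -/
theorem itohD1_sub_itohS1 (K : ℝ) : itohD1 K - itohS1 K = 0.11 * K + 0.09 := by
  simp only [itohS1, itohD1]
  ring

/-- Positivity of that gap on `K ≥ 0`. [cite: Itoh2015HgKnightShift, p. 2] -/
theorem itohD1_gt_itohS1 {K : ℝ} (hK : 0 ≤ K) : itohS1 K < itohD1 K := by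
  have h := itohD1_sub_itohS1 K
  linarith

/-- **D1 against the multilayer line F2** (§1): `D1 − F2 = 0.248 K − 0.017`, positive once
`K > 0.017/0.248 ≈ 0.069 %`, i.e. on the whole superconducting range of shifts D1 assigns more holes
than F2 — «the empirical functions of S1 and D1 are different from the previous fit functions F1 and
F2». [cite: Itoh2015HgKnightShift, p. 2] [cite: MukudaEtAl2012, §2.3 relation F2] -/
theorem itohD1_sub_ksF2 (K : ℝ) : itohD1 K - ksF2 K = 0.248 * K - 0.017 := by
  simp only [itohD1, ksF2]
  ring

/-- **D1 against F1** (§1): `D1 − F1 = 0.238 K − 0.0862`, which changes sign at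
`K = 0.0862/0.238 ∈ (0.3621, 0.3622) %` — below that shift F1 assigns more holes than D1, above it
fewer. [cite: Itoh2015HgKnightShift, p. 2] [cite: KotegawaEtAl2001, relation F1] -/
theorem itohD1_sub_ksF1 (K : ℝ) : itohD1 K - ksF1 K = 0.238 * K - 0.0862 ∧
    (0.3621 : ℝ) < 0.0862 / 0.238 ∧ (0.0862 / 0.238 : ℝ) < 0.3622 := by
  refine ⟨?_, by norm_num, by norm_num⟩
  simp only [itohD1, ksF1]
  ring

/-- **S1 against F2**: `S1 − F2 = 0.138 K − 0.107 < 0` for every `K < 0.107/0.138 ≈ 0.775 %`, so on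
the printed range of single-layer shifts (`K ≤ 0.8 %` in Fig. 3) S1 assigns FEWER holes than F2.
[cite: Itoh2015HgKnightShift, p. 2 and Fig. 3] [cite: MukudaEtAl2012, §2.3 relation F2] -/
theorem itohS1_sub_ksF2 (K : ℝ) : itohS1 K - ksF2 K = 0.138 * K - 0.107 := by
  simp only [itohS1, ksF2]
  ring

/-- **The bilayer convention band at the D1 optimum.**  At the shift `K = 10/37 %` where D1 says
`p = 0.16`, the two multilayer lines give `F2 = 0.10997…` and `F1 = 0.18186…`: the three printed
lines that have been applied to double layers spread the assigned hole content of ONE measured shift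
over `(0.1099, 0.1819)`. [cite: Itoh2015HgKnightShift, Fig. 4(b)] [cite: MukudaEtAl2012, §2.3] -/
theorem bilayer_convention_band :
    itohD1 (10 / 37) = 0.16 ∧
    0.1099 < ksF2 (10 / 37) ∧ ksF2 (10 / 37) < 0.11 ∧
    0.1818 < ksF1 (10 / 37) ∧ ksF1 (10 / 37) < 0.1819 := by
  refine ⟨?_, ?_, ?_, ?_, ?_⟩ <;> norm_num [itohD1, ksF1, ksF2]

/-- Error propagation under D1 and S1: intercept-free, slopes `0.74` and `0.63` (cf. `0.492` under
F2, `ksF2_errorBar`). [cite: Itoh2015HgKnightShift, p. 2] -/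
theorem itoh_errorBars (K δ : ℝ) :
    itohD1 (K + δ) - itohD1 K = 0.74 * δ ∧ itohS1 (K + δ) - itohS1 K = 0.63 * δ := by
  constructor
  · simp only [itohD1]; ring
  · simp only [itohS1]; ring

/-- **What D1 would say for the Hg-1223 planes of §7** (printed shifts `K = 0.41 / 0.32 %`,
[ShimizuEtAl2011] Table II): `D1 = 0.2634 / 0.1968`, against F2's `0.17872 / 0.13444` (`hg1223_F2`)
— the OP–IP imbalance becomes `0.0666` instead of `0.04428`.  [Itoh2015HgKnightShift] leaves open
which line applies to triple layers («one should take into consideration which type relation is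
relevant»); this theorem only records the size of the choice. [cite: Itoh2015HgKnightShift, p. 3] [cite: ShimizuEtAl2011, Table II] -/
theorem hg1223_D1_vs_F2 :
    itohD1 0.41 = 0.2634 ∧ itohD1 0.32 = 0.1968 ∧ itohD1 0.41 - itohD1 0.32 = 0.0666 ∧
    itohD1 0.41 - ksF2 0.41 = 0.08468 ∧ itohD1 0.32 - ksF2 0.32 = 0.06236 := by
  refine ⟨?_, ?_, ?_, ?_, ?_⟩ <;> norm_num [itohD1, ksF2]


end

end Literature.MathematicalPhysics.QuantumLattice
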